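import Literature.ComputerArithmetic.RumpOgitaOishi2008.ExtractVector
import Literature.ComputerArithmetic.JeannerodRump2013.InnerProduct
import Mathlib.Data.Matrix.Basic
import Mathlib.Data.Nat.Log
import Mathlib.Data.Int.Log

/-!
# Ozaki–Ogita–Oishi–Rump 2012: error-free transformation of a matrix product computed with
# ordinary (fast, blocked, any-order) floating-point matrix multiplication — the "Ozaki scheme"

HONEST FRAMING (ENGINES group, engine `quad`, part QUAD-4 — batched evaluation / code-generation
kernels / profiler): shared numerical engines serving client cells; rigour lives in the verifiers;
every published number belongs to a client cell's ledger, not to the engines group. This file types,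
at FORMAT LEVEL (precision `p`, gradual underflow threshold `2^emin`, any round-to-nearest `fl`), the
one theorem behind accurate / reproducible GEMM "on top of vendor BLAS": split `A` and `B` row- and
column-wise into floating-point matrices with few significant bits (`A = Σ_r A^(r)`, `B = Σ_s B^(s)`,
splitting by Rump–Ogita–Oishi's `ExtractScalar` with `σᵢ = 2^α·2^{Pᵢ}`), and then EVERY floating-point
evaluation of every product `A^(r)B^(s)` — whatever the order of the `n` products and additions of an
entry, with or without fused multiply-add, in any blocking — is exact: `fl(A^(r)B^(s)) = A^(r)B^(s)`
(THEOREM 1). The a priori bound of the `k`-fold partial scheme (THEOREM 2, eq. (30)–(31)) follows from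
the decay `σ^(w+1) ≤ 2^{α−h}σ^(w)` of the splitting scales and the any-order inner-product bound of
`JeannerodRump2013`.

SOURCE. K. Ozaki, T. Ogita, S. Oishi, S. M. Rump, *Error-free transformations of matrix multiplication
by using fast routines of matrix multiplication and its applications*, Numer. Algorithms 59 (2012)
95–118, doi 10.1007/s11075-011-9478-1 [cite: OzakiOgitaOishiRump2012] (read from the authors' copy,
22 pp.; page numbers below are those of that copy: §2.1–2.2 pp. 3–4, §2.3 eqs. (6)–(10) pp. 4–8, §2.4
eqs. (11)–(16), Remarks 3–4 and Theorem 1 pp. 8–11 (proof (17)–(24) p. 11), §3 eqs. (26)–(29) and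
Algorithm 5 pp. 14–16, §4.1 Theorem 2 eqs. (30)–(41) pp. 18–20, Corollary 1 pp. 20–21).

DICTIONARY (paper ↦ this file).
* `F`, `u`, `fl(·)` ↦ `IsFloat p emin`, `unitRoundoff p = 2^{-p}`, a map `fl` with `IsRoundNearest p emin fl`
  (ANY tie rule: the paper assumes ties-to-even, which it needs only through property (4) of
  `ExtractScalar`; the tree's `abs_extractScalar_fst_le` gives (4) for every tie rule when `M = α < p`).
  `h := −log₂u = p`.
* "no overflow" ↦ automatic (unbounded exponents above); "no underflow" ↦ the explicit hypotheses
  `emin ≤ …` below (each says that a grid `u²σᵢτⱼℤ` the proof works on is not finer than `2^{emin}ℤ`),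
  and the `n·2^{emin}` terms of Theorem 2, absent in print.
* `⌈log₂ n⌉`, `α` (11), `β` (6) ↦ `Nat.clog 2 n`, `alpha p n`, `beta p n` (`alpha_add_beta : α + β = p`,
  footnote 2); (22) `n·2^{−2α} ≤ u` ↦ `mul_pow_two_beta_le : n·2^{2β} ≤ 2^p`.
* `ExtractScalar(p, σ)` (Algorithm 1) ↦ `RumpOgitaOishi2008.extractScalar fl σ x`; `f ∈ uσℤ` ↦
  `OnGrid (2^c) f` with `2^c = uσ`; one splitting step (13)/(15) of an entry with row scale
  `σ = 2^α·2^P` ↦ `splitEntry fl α P x` (part, remainder).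
* "`fl(A^(r)B^(s))` computed by a fast routine, in any order / blocking, with or without FMA" ↦ for each
  entry an arbitrary `JeannerodRump2013.DotTree` whose leaves are a permutation of the `n` products
  `a_{ik}b_{kj}` (`rleaf` = rounded product, `xleaf` = product absorbed by a fused multiply-add, `node` =
  one rounded addition); `fl(⋯) = ⋯` ↦ `T.eval fl = ∑ k, a i k * b k j = (A * B) i j`.
* `A^(w)`, `A̲^(w)` (parts and remainders of the repeated splitting (14)–(15), `σ^(w)ᵢ = 2^α 2^{P^(w)ᵢ}`) ↦
  `partM fl α P A w`, `remM fl α P A w` (0-based: `remM … 0 = A`), for a ROW-EXPONENT SCHEDULE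
  `P : ℕ → Fin m → ℤ` subject to the paper's inequality after (14), `|a̲^(w)_{ik}| ≤ 2^{P^(w)ᵢ}`
  (hypotheses `hV…`), with floating-point scales `σ^(w)ᵢ ≥ 2^{emin}` (hypotheses `hE…`); the paper's
  choice (12) `P^(w)ᵢ = ⌈log₂ max_k |a̲^(w)_{ik}|⌉` is one valid schedule (`abs_le_two_zpow_clog`), and its
  decay (37) is the hypothesis `hT… : P^(w+1)ᵢ ≤ P^(w)ᵢ − β` unless row `i` is already zero (its splitting
  finished), which `sweep_spec`/`clog_rem_succ_le` show is always available. Columns of `B` are split as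
  rows of `Bᵀ` (as Algorithm 5 does: `SplitMat(Bᵀ)`).
* The expansion (10)/(29) ↦ `mul_expansion` (0-based `K = k − 1`), (16) ↦ `eq_sum_parts_add_rem`.

TYPED AND PROVED: (6), (11), footnote 2, (22); Remark 2; properties (2)–(5) of one splitting step with
`M = α` and the exactness of (13)–(15); THEOREM 1 in three forms (any-order evaluation of a sum of
numbers on a grid below capacity is exact; dot products of split vectors, §2.3; entries of products of
split matrices, §2.4) and for the parts `A^(r)`, `B^(s)` of the repeated splitting at any sweeps `r, s`;
(16) with an explicit sweep count (termination in gradual underflow); (29); (35)–(40); THEOREM 2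
eq. (30) entrywise with the format-level underflow term, and (31).
NOT TYPED: Algorithms 3–5 as programs (MATLAB loops, the sparse-storage heuristics, `δ`), Remark 4's
heuristic estimate of `n_A` via `m_A`, eq. (32) and Corollary 1 (faithful final summation), the level-3
fraction (46), all timings and numerical tables.
-/

namespace Literature.ComputerArithmetic.OzakiOgitaOishiRump2012

open Literature.ComputerArithmetic.JeannerodRump2018
open Literature.ComputerArithmetic.RumpOgitaOishi2008
open Literature.ComputerArithmetic.JeannerodRump2013 (DotTree abs_dot_sub_le_gamma)
open Literature.ComputerArithmetic.Higham2002 (gamma)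
open Literature.ComputerArithmetic.JoldesMullerPopescu2017 (isFloat_two_zpow)
open Finset
open scoped Matrix

variable {p : ℕ} {emin : ℤ} {fl : ℚ → ℚ}

/-! ### §2.3 eq. (6), §2.4 eq. (11), footnote 2 and eq. (22): the constants `α` and `β` -/

/-- Eq. (11): `α = ⌈(⌈log₂ n⌉ − log₂u)/2⌉ = ⌈(⌈log₂ n⌉ + p)/2⌉` (the number of leading bits removed by
one splitting is `p − α = β`). [cite: OzakiOgitaOishiRump2012, §2.4 eq. (11)] -/
def alpha (p n : ℕ) : ℕ := (Nat.clog 2 n + p + 1) / 2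

/-- Eq. (6): `β = ⌊(−log₂u − ⌈log₂ n⌉)/2⌋ = ⌊(p − ⌈log₂ n⌉)/2⌋`, the number of significant bits of a
part. [cite: OzakiOgitaOishiRump2012, §2.3 eq. (6)] -/
def beta (p n : ℕ) : ℕ := (p - Nat.clog 2 n) / 2

/-- `α` is the ceiling in (11): `⌈log₂ n⌉ + p ≤ 2α ≤ ⌈log₂ n⌉ + p + 1`.
[cite: OzakiOgitaOishiRump2012, §2.4 eq. (11)] -/
theorem two_mul_alpha_bounds (p n : ℕ) :
    Nat.clog 2 n + p ≤ 2 * alpha p n ∧ 2 * alpha p n ≤ Nat.clog 2 n + p + 1 := by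
  unfold alpha; omega

/-- `β` is the floor in (6): `p − ⌈log₂ n⌉ − 1 ≤ 2β ≤ p − ⌈log₂ n⌉` (for `⌈log₂ n⌉ ≤ p`).
[cite: OzakiOgitaOishiRump2012, §2.3 eq. (6)] -/
theorem two_mul_beta_bounds {p n : ℕ} (h : Nat.clog 2 n ≤ p) :
    p - Nat.clog 2 n - 1 ≤ 2 * beta p n ∧ 2 * beta p n ≤ p - Nat.clog 2 n := by
  unfold beta; omega

/-- FOOTNOTE 2: `β + α = −log₂u`, i.e. `α + β = p`. [cite: OzakiOgitaOishiRump2012, §2.4 footnote 2] -/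
theorem alpha_add_beta {p n : ℕ} (h : Nat.clog 2 n ≤ p) : alpha p n + beta p n = p := by
  unfold alpha beta; omega

/-- `α < p` and `β ≥ 1` (a splitting step removes at least one bit) as soon as `n ≤ 2^{p−2}`; `α < p` is
what makes property (4) of `ExtractScalar` with `M = α` hold for every tie rule.
[cite: OzakiOgitaOishiRump2012, §2.4 eq. (11)] -/
theorem alpha_lt_and_one_le_beta {p n : ℕ} (h : Nat.clog 2 n + 2 ≤ p) : alpha p n < p ∧ 1 ≤ beta p n := by
  unfold alpha beta; omega

/-- `n ≤ 2^⌈log₂ n⌉`. [cite: OzakiOgitaOishiRump2012, §2.3 eq. (8)] -/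
theorem le_two_pow_clog (n : ℕ) : n ≤ 2 ^ Nat.clog 2 n := Nat.le_pow_clog (by norm_num) n

/-- EQ. (22) / the last inequality of (8): `n·2^{−2α} ≤ n·2^{−⌈log₂ n⌉ + log₂u} ≤ u`, in the form
`n·2^{2β} ≤ 2^p` (equivalently `n·2^{2β}·u² ≤ u`: `n` products of two `β`-bit parts fit into `p` bits).
[cite: OzakiOgitaOishiRump2012, §2.4 eq. (22)] -/
theorem mul_pow_two_beta_le {p n : ℕ} (h : Nat.clog 2 n ≤ p) : n * 2 ^ (2 * beta p n) ≤ 2 ^ p := by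
  have h2 : 2 * beta p n ≤ p - Nat.clog 2 n := (two_mul_beta_bounds h).2
  calc n * 2 ^ (2 * beta p n) ≤ 2 ^ Nat.clog 2 n * 2 ^ (p - Nat.clog 2 n) :=
        Nat.mul_le_mul (le_two_pow_clog n) (Nat.pow_le_pow_right (by norm_num) h2)
    _ = 2 ^ p := by rw [← pow_add]; congr 1; omega

/-- The same in `ℚ`, the form consumed below: `(n : ℚ)·2^{2β} ≤ 2^p`.
[cite: OzakiOgitaOishiRump2012, §2.4 eq. (22)] -/
theorem mul_pow_two_beta_le_rat {p n : ℕ} (h : Nat.clog 2 n ≤ p) :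
    (n : ℚ) * (2 : ℚ) ^ (2 * beta p n) ≤ (2 : ℚ) ^ p := by
  exact_mod_cast mul_pow_two_beta_le h

/-- The dictionary for (12): `|x| ≤ 2^⌈log₂|x|⌉` — the choice `Pᵢ = ⌈log₂ max_j |a_{ij}|⌉` satisfies the
inequality `|a_{ij}| ≤ 2^{Pᵢ}` that the proofs use. [cite: OzakiOgitaOishiRump2012, §2.4 eq. (12) and Remark 3] -/
theorem abs_le_two_zpow_clog (x : ℚ) : |x| ≤ (2 : ℚ) ^ Int.clog 2 |x| := by
  exact_mod_cast Int.self_le_zpow_clog (R := ℚ) (by norm_num : 1 < 2) |x|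

/-- … and it is the least such exponent: `0 < |x| ≤ 2^E ⟹ ⌈log₂|x|⌉ ≤ E` (this is what makes the scales
(14) decrease, eq. (37)). [cite: OzakiOgitaOishiRump2012, §4.1 eq. (37)] -/
theorem clog_le_of_abs_le {x : ℚ} (hx : x ≠ 0) {E : ℤ} (h : |x| ≤ (2 : ℚ) ^ E) : Int.clog 2 |x| ≤ E := by
  have := (Int.le_zpow_iff_clog_le (R := ℚ) (by norm_num : 1 < 2) (abs_pos.mpr hx) (x := E)).mp
  exact this (by exact_mod_cast h)

/-! ### Remark 2: integers times a power of two below capacity are floating-point numbers -/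

/-- REMARK 2: "if a real number `|f|` is an integer multiple of `2^m` and `|f| < 2^m u⁻¹`, then `f ∈ F`"
— at format level with `2^m ≥ 2^{emin}` and allowing `|f| ≤ 2^p·2^m`.
[cite: OzakiOgitaOishiRump2012, §2.3 Remark 2] -/
theorem remark2 (hp : 1 ≤ p) {f : ℚ} {m : ℤ} (hm : emin ≤ m) (hg : OnGrid ((2 : ℚ) ^ m) f)
    (hle : |f| ≤ (2 : ℚ) ^ p * (2 : ℚ) ^ m) : IsFloat p emin f :=
  isFloat_of_onGrid_two_zpow hp hg hle hm

/-! ### §2.2, Algorithm 1 with `σ = 2^α·2^P` (eqs. (1)–(5)) = one splitting step (13)/(15) of an entry -/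

/-- ONE SPLITTING STEP of an entry `x` of (a row of) the current remainder, row scale `σ = 2^α·2^P`
(eq. (1) with `M = α`, eqs. (13)/(15)): `(part, remainder) = (fl(fl(σ + x) − σ), fl(x − part))`
= `ExtractScalar(x, σ)`. [cite: OzakiOgitaOishiRump2012, §2.4 eqs. (13)–(15)] -/
def splitEntry (fl : ℚ → ℚ) (α : ℕ) (P : ℤ) (x : ℚ) : ℚ × ℚ :=
  extractScalar fl ((2 : ℚ) ^ ((α : ℤ) + P)) x

/-- The operations of `splitEntry`, literally (13): `A^(1) = fl((A + σeᵀ) − σeᵀ)`, `A̲^(2) = fl(A − A^(1))`.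
[cite: OzakiOgitaOishiRump2012, §2.4 eq. (13)] -/
theorem splitEntry_eq (fl : ℚ → ℚ) (α : ℕ) (P : ℤ) (x : ℚ) :
    splitEntry fl α P x =
      (fl (fl ((2 : ℚ) ^ ((α : ℤ) + P) + x) - (2 : ℚ) ^ ((α : ℤ) + P)),
        fl (x - fl (fl ((2 : ℚ) ^ ((α : ℤ) + P) + x) - (2 : ℚ) ^ ((α : ℤ) + P)))) := rfl

/-- Both outputs of a splitting step are floating-point numbers. [cite: OzakiOgitaOishiRump2012, §2.2 Algorithm 1] -/
theorem isFloat_splitEntry (hfl : IsRoundNearest p emin fl) (α : ℕ) (P : ℤ) (x : ℚ) :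
    IsFloat p emin (splitEntry fl α P x).1 ∧ IsFloat p emin (splitEntry fl α P x).2 :=
  isFloat_extractScalar hfl _ x

/-- PROPERTIES (2)–(5) OF ALGORITHM 1 with `σ = 2^α 2^P`, `M = α < p`, and the EXACTNESS of (13)–(15):
for `x ∈ F` with `|x| ≤ 2^P` (= `2^{−M}σ`, property (2)) and `2^{emin} ≤ σ`: the part `q` lies on
`uσℤ = 2^{α+P−p}ℤ` (5) and `|q| ≤ 2^{−α}σ = 2^P` (4); the remainder is EXACTLY `x − q` ("as in Algorithm 1,
`A = A^(1) + A̲^(2)`") and `|x − q| ≤ uσ = 2^{α+P−p} = 2^{P−β}` (3).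
[cite: OzakiOgitaOishiRump2012, §2.2 eqs. (2)–(5) and §2.4 eqs. (13)–(15)] -/
theorem splitEntry_spec (hp : 1 ≤ p) (hfl : IsRoundNearest p emin fl) {α : ℕ} (hα : α < p) {P : ℤ}
    (hP : emin ≤ (α : ℤ) + P) {x : ℚ} (hx : IsFloat p emin x) (hxP : |x| ≤ (2 : ℚ) ^ P) :
    OnGrid ((2 : ℚ) ^ ((α : ℤ) + P - p)) (splitEntry fl α P x).1 ∧
      |(splitEntry fl α P x).1| ≤ (2 : ℚ) ^ P ∧
      (splitEntry fl α P x).2 = x - (splitEntry fl α P x).1 ∧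
      x = (splitEntry fl α P x).1 + (splitEntry fl α P x).2 ∧
      |(splitEntry fl α P x).2| ≤ (2 : ℚ) ^ ((α : ℤ) + P - p) := by
  have h2 : (0 : ℚ) < (2 : ℚ) ^ ((α : ℤ) + P) := two_zpow_pos _
  have hPk : (2 : ℚ) ^ P ≤ (2 : ℚ) ^ ((α : ℤ) + P) :=
    zpow_le_zpow_right₀ (by norm_num) (by omega)
  have hxs : |x| ≤ (2 : ℚ) ^ ((α : ℤ) + P) := hxP.trans hPk
  obtain ⟨-, h2eq, hsum, habs2, hgrid⟩ := extractScalar_eft hp hfl hP hx hxs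
  have hdiv : (2 : ℚ) ^ ((α : ℤ) + P) / 2 ^ α = (2 : ℚ) ^ P := by
    rw [div_eq_iff (by positivity), ← zpow_natCast, ← zpow_add₀ (by norm_num : (2 : ℚ) ≠ 0)]
    congr 1; ring
  have h4 := abs_extractScalar_fst_le hp hfl hP hx hα (by rw [hdiv]; exact hxP)
  rw [hdiv] at h4
  rw [u_mul_two_zpow] at habs2 hgrid
  exact ⟨hgrid, h4, h2eq, hsum, habs2⟩

/-! ### Theorem 1, the mechanism: any-order evaluation of a sum on a grid below capacity is exact -/

/-- THE MECHANISM OF THEOREM 1 (proof (17)–(24) with Remark 2), for an arbitrary evaluation scheme: if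
the terms `zₖ` of a sum lie on a dyadic grid `2^jℤ` with `2^j ≥ 2^{emin}` and `Σ|zₖ| ≤ 2^p·2^j`, then
EVERY floating-point evaluation of `Σ zₖ` — terms rounded individually (`rleaf`, a multiplication) or
kept exact for a fused multiply-add (`xleaf`), partial sums added in any order and blocking — returns the
exact sum: every intermediate result is on the grid and of modulus `≤ Σ|zₖ| ≤ 2^p 2^j`, hence in `F`.
[cite: OzakiOgitaOishiRump2012, Theorem 1 (proof, eqs. (18)–(24))] -/
theorem dotTree_eval_eq_exact (hp : 1 ≤ p) (hfl : IsRoundNearest p emin fl) {j : ℤ} (hj : emin ≤ j) :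
    ∀ T : DotTree, (∀ z ∈ T.leaves, OnGrid ((2 : ℚ) ^ j) z) →
      T.absSum ≤ (2 : ℚ) ^ p * (2 : ℚ) ^ j → T.eval fl = T.exact
  | .rleaf z, hg, hs => by
      have hz : IsFloat p emin z :=
        isFloat_of_onGrid_two_zpow hp (hg z (by simp [DotTree.leaves]))
          (by simpa [DotTree.absSum, DotTree.leaves] using hs) hj
      simpa [DotTree.eval, DotTree.exact] using fl_eq_self hfl hz
  | .xleaf z, _, _ => rfl
  | .node l r, hg, hs => by
      have hgl : ∀ z ∈ l.leaves, OnGrid ((2 : ℚ) ^ j) z := fun z hz => hg z (by simp [DotTree.leaves, hz])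
      have hgr : ∀ z ∈ r.leaves, OnGrid ((2 : ℚ) ^ j) z := fun z hz => hg z (by simp [DotTree.leaves, hz])
      have hn := DotTree.absSum_node l r
      have hl0 := DotTree.absSum_nonneg l
      have hr0 := DotTree.absSum_nonneg r
      have hsl : l.absSum ≤ (2 : ℚ) ^ p * (2 : ℚ) ^ j := by linarith
      have hsr : r.absSum ≤ (2 : ℚ) ^ p * (2 : ℚ) ^ j := by linarith
      simp only [DotTree.eval, DotTree.exact]
      rw [dotTree_eval_eq_exact hp hfl hj l hgl hsl, dotTree_eval_eq_exact hp hfl hj r hgr hsr]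
      have hF : IsFloat p emin (l.exact + r.exact) := by
        refine isFloat_of_onGrid_two_zpow hp ?_ ?_ hj
        · rw [DotTree.exact_eq_sum, DotTree.exact_eq_sum]
          exact (onGrid_list_sum hgl).add (onGrid_list_sum hgr)
        · have := DotTree.abs_exact_le_absSum (.node l r)
          simp only [DotTree.exact] at this
          linarith
      exact fl_eq_self hfl hF

/-- Grid elements multiply onto the product grid: `x ∈ 2^cℤ`, `y ∈ 2^dℤ` ⟹ `xy ∈ 2^{c+d}ℤ` (eq. (18):
`a^(r)_{ik}b^(s)_{kj} ∈ u²σᵢτⱼℤ`). [cite: OzakiOgitaOishiRump2012, Theorem 1 (proof, eq. (18))] -/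
theorem onGrid_mul {c d : ℤ} {x y : ℚ} (hx : OnGrid ((2 : ℚ) ^ c) x) (hy : OnGrid ((2 : ℚ) ^ d) y) :
    OnGrid ((2 : ℚ) ^ (c + d)) (x * y) := by
  obtain ⟨a, rfl⟩ := hx
  obtain ⟨b, rfl⟩ := hy
  exact ⟨a * b, by rw [zpow_add₀ (by norm_num : (2 : ℚ) ≠ 0)]; push_cast; ring⟩

/-- Bounded parts give bounded products (eq. (20)–(21), one term): `|x| ≤ 2^s·2^c`, `|y| ≤ 2^t·2^d` ⟹
`|xy| ≤ 2^{s+t}·2^{c+d}`. [cite: OzakiOgitaOishiRump2012, Theorem 1 (proof, eqs. (20)–(21))] -/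
theorem abs_mul_le_of_parts {c d : ℤ} {s t : ℕ} {x y : ℚ} (hx : |x| ≤ (2 : ℚ) ^ s * (2 : ℚ) ^ c)
    (hy : |y| ≤ (2 : ℚ) ^ t * (2 : ℚ) ^ d) :
    |x * y| ≤ (2 : ℚ) ^ (s + t) * (2 : ℚ) ^ (c + d) := by
  rw [abs_mul, pow_add, zpow_add₀ (by norm_num : (2 : ℚ) ≠ 0)]
  have h0 : 0 ≤ (2 : ℚ) ^ s * (2 : ℚ) ^ c := by positivity
  calc |x| * |y| ≤ ((2 : ℚ) ^ s * (2 : ℚ) ^ c) * ((2 : ℚ) ^ t * (2 : ℚ) ^ d) :=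
        mul_le_mul hx hy (abs_nonneg y) h0
    _ = _ := by ring

/-- THEOREM 1 FOR A DOT PRODUCT (§2.3, eqs. (7)–(8) and Figs. 2–4): if `xₖ ∈ 2^cℤ`, `|xₖ| ≤ 2^s 2^c`
(parts with at most `s` significant bits on the grid `uσℤ = 2^cℤ`), `yₖ ∈ 2^dℤ`, `|yₖ| ≤ 2^t 2^d`,
`n·2^{s+t} ≤ 2^p` and `2^{emin} ≤ 2^{c+d}` (no underflow), then every floating-point evaluation of
`xᵀy` — any order, any blocking, with or without FMA — is exact: `fl(xᵀy) = xᵀy`.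
[cite: OzakiOgitaOishiRump2012, §2.3 eqs. (7)–(8) and Theorem 1] -/
theorem dot_eval_eq_exact (hp : 1 ≤ p) (hfl : IsRoundNearest p emin fl) {n : ℕ} {c d : ℤ} {s t : ℕ}
    (x y : Fin n → ℚ) (hx : ∀ k, OnGrid ((2 : ℚ) ^ c) (x k)) (hxb : ∀ k, |x k| ≤ (2 : ℚ) ^ s * (2 : ℚ) ^ c)
    (hy : ∀ k, OnGrid ((2 : ℚ) ^ d) (y k)) (hyb : ∀ k, |y k| ≤ (2 : ℚ) ^ t * (2 : ℚ) ^ d)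
    (hn : (n : ℚ) * (2 : ℚ) ^ (s + t) ≤ (2 : ℚ) ^ p) (he : emin ≤ c + d)
    (T : DotTree) (hT : T.leaves.Perm (List.ofFn fun k => x k * y k)) :
    T.eval fl = ∑ k, x k * y k := by
  have hex : T.exact = ∑ k, x k * y k := by
    rw [DotTree.exact_eq_sum, hT.sum_eq, List.sum_ofFn]
  have habs : T.absSum = ∑ k, |x k * y k| := by
    unfold DotTree.absSum
    rw [(hT.map abs).sum_eq, List.map_ofFn, List.sum_ofFn]
    rfl
  rw [← hex]
  refine dotTree_eval_eq_exact hp hfl he T ?_ ?_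
  · intro z hz
    rw [hT.mem_iff, List.mem_ofFn] at hz
    obtain ⟨k, rfl⟩ := hz
    exact onGrid_mul (hx k) (hy k)
  · rw [habs]
    calc ∑ k, |x k * y k| ≤ ∑ _k : Fin n, (2 : ℚ) ^ (s + t) * (2 : ℚ) ^ (c + d) :=
          Finset.sum_le_sum fun k _ => abs_mul_le_of_parts (hxb k) (hyb k)
      _ = (n : ℚ) * (2 : ℚ) ^ (s + t) * (2 : ℚ) ^ (c + d) := by
          rw [Finset.sum_const, Finset.card_univ, Fintype.card_fin, nsmul_eq_mul]; ring
      _ ≤ (2 : ℚ) ^ p * (2 : ℚ) ^ (c + d) :=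
          mul_le_mul_of_nonneg_right hn (two_zpow_pos _).le

/-- THEOREM 1 FOR MATRICES, grid form: `A' ∈ F^{m×n}` with row `i` on the grid `2^{cᵢ}ℤ` (`= uσᵢℤ`) and
`|a'_{ik}| ≤ 2^s 2^{cᵢ}`, `B' ∈ F^{n×q}` with column `j` on `2^{dⱼ}ℤ` (`= uτⱼℤ`) and `|b'_{kj}| ≤ 2^t 2^{dⱼ}`,
`n·2^{s+t} ≤ 2^p`, and no underflow (`2^{emin} ≤ u²σᵢτⱼ`): then there is no rounding error in ANY
floating-point evaluation of `A'B'` by a (fast, blocked, multithreaded, FMA-using) routine computing each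
entry as a sum of its `n` products: `fl(A'B') = A'B'`. [cite: OzakiOgitaOishiRump2012, Theorem 1] -/
theorem matrix_eval_eq_mul (hp : 1 ≤ p) (hfl : IsRoundNearest p emin fl) {m n q : ℕ}
    (A : Matrix (Fin m) (Fin n) ℚ) (B : Matrix (Fin n) (Fin q) ℚ) {c : Fin m → ℤ} {d : Fin q → ℤ}
    {s t : ℕ} (hA : ∀ i k, OnGrid ((2 : ℚ) ^ c i) (A i k)) (hAb : ∀ i k, |A i k| ≤ (2 : ℚ) ^ s * (2 : ℚ) ^ c i)
    (hB : ∀ k j, OnGrid ((2 : ℚ) ^ d j) (B k j)) (hBb : ∀ k j, |B k j| ≤ (2 : ℚ) ^ t * (2 : ℚ) ^ d j)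
    (hn : (n : ℚ) * (2 : ℚ) ^ (s + t) ≤ (2 : ℚ) ^ p) (he : ∀ i j, emin ≤ c i + d j)
    (i : Fin m) (j : Fin q) (T : DotTree) (hT : T.leaves.Perm (List.ofFn fun k => A i k * B k j)) :
    T.eval fl = (A * B) i j := by
  rw [Matrix.mul_apply]
  exact dot_eval_eq_exact hp hfl (fun k => A i k) (fun k => B k j) (fun k => hA i k) (fun k => hAb i k)
    (fun k => hB k j) (fun k => hBb k j) hn (he i j) T hT


/-! ### §2.4 eq. (16) and §3.1 eq. (29): unevaluated sums and the `k`-fold expansion (pure algebra) -/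

/-- TELESCOPING behind (15)–(16) and (26)/(28): if `A̲^(w) = A^(w) + A̲^(w+1)` for all `w` (0-based:
`r 0 = A`), then `A = Σ_{w<K} A^(w) + A̲^(K)` for every `K`. [cite: OzakiOgitaOishiRump2012, §2.4 eqs. (15)–(16)] -/
theorem rem_zero_eq_sum_add_rem {M : Type*} [AddCommMonoid M] (a r : ℕ → M)
    (h : ∀ w, r w = a w + r (w + 1)) : ∀ K : ℕ, r 0 = (∑ w ∈ range K, a w) + r K
  | 0 => by simp
  | K + 1 => by rw [sum_range_succ, rem_zero_eq_sum_add_rem a r h K, h K, add_assoc]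

/-- EQ. (29) (and (10) for dot products, (27) for `k = 2`), 0-based with `K = k − 1`: writing `aᵢ = A^(i+1)`,
`r̲aᵢ = A̲^(i+1)` (so `r̲a₀ = A`, `r̲aᵢ = aᵢ + r̲aᵢ₊₁`) and likewise for `B`,
`AB = Σ_{i+j<K} aᵢbⱼ + Σ_{i<K} aᵢ·r̲b_{K−i} + r̲a_K·B` — `K(K+1)/2 + K + 1 = k(k−1)/2 + k` matrix
products, of which the first group is error-free by Theorem 1. Valid for rectangular matrices over any
(non-unital, non-associative) semiring. [cite: OzakiOgitaOishiRump2012, §3.1 eq. (29) and §2.3 eq. (10)] -/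
theorem mul_expansion {R : Type*} [NonUnitalNonAssocSemiring R] {ι κ ν : Type*} [Fintype κ]
    (a ra : ℕ → Matrix ι κ R) (b rb : ℕ → Matrix κ ν R)
    (ha : ∀ w, ra w = a w + ra (w + 1)) (hb : ∀ w, rb w = b w + rb (w + 1)) :
    ∀ K : ℕ, ra 0 * rb 0 =
      (∑ i ∈ range K, ∑ j ∈ range (K - i), a i * b j) + (∑ i ∈ range K, a i * rb (K - i)) + ra K * rb 0
  | 0 => by simp
  | K + 1 => by
      rw [mul_expansion a ra b rb ha hb K]
      have h1 : ∑ i ∈ range (K + 1), ∑ j ∈ range (K + 1 - i), a i * b j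
          = (∑ i ∈ range K, ∑ j ∈ range (K - i), a i * b j) + (∑ i ∈ range K, a i * b (K - i))
            + a K * b 0 := by
        rw [sum_range_succ, show K + 1 - K = 1 by omega, sum_range_one, ← sum_add_distrib]
        congr 1
        refine sum_congr rfl fun i hi => ?_
        rw [mem_range] at hi
        rw [show K + 1 - i = (K - i) + 1 by omega, sum_range_succ]
      have h2 : ∑ i ∈ range (K + 1), a i * rb (K + 1 - i)
          = (∑ i ∈ range K, a i * rb (K - i + 1)) + a K * rb 1 := by
        rw [sum_range_succ, show K + 1 - K = 1 by omega]
        congr 1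
        refine sum_congr rfl fun i hi => ?_
        rw [mem_range] at hi
        rw [show K + 1 - i = K - i + 1 by omega]
      have h3 : ∑ i ∈ range K, a i * rb (K - i)
          = (∑ i ∈ range K, a i * b (K - i)) + ∑ i ∈ range K, a i * rb (K - i + 1) := by
        rw [← sum_add_distrib]
        refine sum_congr rfl fun i _ => ?_
        rw [hb (K - i), Matrix.mul_add]
      have h4 : ra K * rb 0 = a K * b 0 + a K * rb 1 + ra (K + 1) * rb 0 := by
        have : a K * rb 0 = a K * b 0 + a K * rb 1 := by
          rw [show a K * rb 0 = a K * (b 0 + rb 1) by rw [← hb 0], Matrix.mul_add]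
        rw [ha K, Matrix.add_mul, this]
      rw [h3, h4, h1, h2]
      abel

/-- The FULL expansion behind (9)/(16): once both splittings have terminated (`A = Σ_{r<N} A^(r)`,
`B = Σ_{s<N'} B^(s)`), `AB = Σ_r Σ_s A^(r)B^(s)` — `n_A·n_B` products, every one error-free by Theorem 1.
[cite: OzakiOgitaOishiRump2012, §2.4 (display after Remark 4) and Theorem 1] -/
theorem mul_full_expansion {R : Type*} [NonUnitalNonAssocSemiring R] {ι κ ν : Type*} [Fintype κ]
    (a : ℕ → Matrix ι κ R) (b : ℕ → Matrix κ ν R) (N N' : ℕ) :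
    (∑ r ∈ range N, a r) * (∑ s ∈ range N', b s) = ∑ r ∈ range N, ∑ s ∈ range N', a r * b s := by
  rw [Matrix.sum_mul]
  exact sum_congr rfl fun r _ => Matrix.mul_sum _ _ _

/-! ### §2.4 eqs. (14)–(16): repeated row-wise splitting of a matrix with a scale schedule -/

section Splitting

variable {m n : ℕ}

/-- THE REMAINDERS `A̲^(w+1)` of the repeated splitting (14)–(15), 0-based (`remM … 0 = A`), for a row
scale schedule `P` (`σ^(w+1)ᵢ = 2^α·2^{P w i}`): `A̲^(w+2)_{ik} = fl(A̲^(w+1)_{ik} − A^(w+1)_{ik})`.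
[cite: OzakiOgitaOishiRump2012, §2.4 eqs. (14)–(15)] -/
def remM (fl : ℚ → ℚ) (α : ℕ) (P : ℕ → Fin m → ℤ) (A : Matrix (Fin m) (Fin n) ℚ) :
    ℕ → Matrix (Fin m) (Fin n) ℚ
  | 0 => A
  | w + 1 => fun i k => (splitEntry fl α (P w i) (remM fl α P A w i k)).2

/-- THE PARTS `A^(w+1) = fl((A̲^(w+1) + σ^(w+1)eᵀ) − σ^(w+1)eᵀ)` of the repeated splitting, 0-based.
[cite: OzakiOgitaOishiRump2012, §2.4 eqs. (14)–(15)] -/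
def partM (fl : ℚ → ℚ) (α : ℕ) (P : ℕ → Fin m → ℤ) (A : Matrix (Fin m) (Fin n) ℚ) (w : ℕ) :
    Matrix (Fin m) (Fin n) ℚ :=
  fun i k => (splitEntry fl α (P w i) (remM fl α P A w i k)).1

variable {α : ℕ} {P : ℕ → Fin m → ℤ} {A : Matrix (Fin m) (Fin n) ℚ}

/-- `A̲^(1) = A`. [cite: OzakiOgitaOishiRump2012, §3.1 (display before (29))] -/
theorem remM_zero (fl : ℚ → ℚ) (α : ℕ) (P : ℕ → Fin m → ℤ) (A : Matrix (Fin m) (Fin n) ℚ) :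
    remM fl α P A 0 = A := rfl

/-- The recursion (15), entrywise. [cite: OzakiOgitaOishiRump2012, §2.4 eq. (15)] -/
theorem remM_succ_apply (fl : ℚ → ℚ) (α : ℕ) (P : ℕ → Fin m → ℤ) (A : Matrix (Fin m) (Fin n) ℚ)
    (w : ℕ) (i : Fin m) (k : Fin n) :
    remM fl α P A (w + 1) i k = (splitEntry fl α (P w i) (remM fl α P A w i k)).2 := rfl

/-- Parts and remainders are floating-point matrices (for `A ∈ F^{m×n}`).
[cite: OzakiOgitaOishiRump2012, §2.4 eqs. (14)–(15)] -/
theorem isFloat_remM (hfl : IsRoundNearest p emin fl) (hA : ∀ i k, IsFloat p emin (A i k)) :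
    ∀ (w : ℕ) (i : Fin m) (k : Fin n), IsFloat p emin (remM fl α P A w i k)
  | 0, i, k => hA i k
  | _ + 1, _, _ => (isFloat_splitEntry hfl _ _ _).2

/-- [cite: OzakiOgitaOishiRump2012, §2.4 eqs. (14)–(15)] -/
theorem isFloat_partM (hfl : IsRoundNearest p emin fl) (w : ℕ) (i : Fin m) (k : Fin n) :
    IsFloat p emin (partM fl α P A w i k) :=
  (isFloat_splitEntry hfl _ _ _).1

/-- ONE SWEEP OF (14)–(15) at an entry, under the schedule's inequality `|a̲^(w)_{ik}| ≤ 2^{P^(w)ᵢ}` (the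
line after (14)) with `α + β = p`, `β ≥ 1` and `σ^(w)ᵢ = 2^α 2^{P^(w)ᵢ} ∈ F` (`≥ 2^{emin}`): the part
`a^(w)_{ik}` lies on `uσ^(w)ᵢℤ = 2^{P^(w)ᵢ−β}ℤ` and `|a^(w)_{ik}| ≤ 2^{−α}σ^(w)ᵢ = 2^{P^(w)ᵢ}` ((35), i.e.
(4)–(5)); the next remainder is EXACTLY `a̲^(w)_{ik} − a^(w)_{ik}` ((15) is error-free) and
`|a̲^(w+1)_{ik}| ≤ uσ^(w)ᵢ = 2^{P^(w)ᵢ−β}` ((36), i.e. (3)).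
[cite: OzakiOgitaOishiRump2012, §2.4 eqs. (14)–(15) and §4.1 eqs. (35)–(36)] -/
theorem sweep_spec (hfl : IsRoundNearest p emin fl) {β : ℕ} (hαβ : α + β = p) (hβ : 1 ≤ β)
    (hA : ∀ i k, IsFloat p emin (A i k)) {w : ℕ} {i : Fin m} {k : Fin n}
    (hV : |remM fl α P A w i k| ≤ (2 : ℚ) ^ P w i) (hE : emin ≤ (α : ℤ) + P w i) :
    OnGrid ((2 : ℚ) ^ (P w i - β)) (partM fl α P A w i k) ∧
      |partM fl α P A w i k| ≤ (2 : ℚ) ^ P w i ∧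
      remM fl α P A (w + 1) i k = remM fl α P A w i k - partM fl α P A w i k ∧
      |remM fl α P A (w + 1) i k| ≤ (2 : ℚ) ^ (P w i - β) := by
  have hp : 1 ≤ p := by omega
  have hα : α < p := by omega
  obtain ⟨hg, hb, hr, -, hrb⟩ := splitEntry_spec hp hfl hα hE (isFloat_remM hfl hA w i k) hV
  have hexp : (α : ℤ) + P w i - p = P w i - β := by omega
  rw [hexp] at hg hrb
  exact ⟨hg, hb, hr, hrb⟩

/-- A zero row stays zero and produces zero parts (the splitting of that row has finished), provided its
scale is a floating-point number. [cite: OzakiOgitaOishiRump2012, §2.4 eq. (16)] -/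
theorem partM_eq_zero_of_row_zero (hfl : IsRoundNearest p emin fl) (hp : 1 ≤ p) {w : ℕ} {i : Fin m}
    (h0 : ∀ k, remM fl α P A w i k = 0) (hE : emin ≤ (α : ℤ) + P w i) (k : Fin n) :
    partM fl α P A w i k = 0 ∧ remM fl α P A (w + 1) i k = 0 := by
  have hx : IsFloat p emin (0 : ℚ) := ⟨0, emin, by positivity, le_rfl, by simp⟩
  obtain ⟨h1, h2, -⟩ := extractScalar_eft hp hfl hE hx (x := 0)
    (by rw [abs_zero]; exact (two_zpow_pos _).le)
  rw [add_zero, fl_eq_self hfl (isFloat_two_zpow hp hE), sub_self] at h1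
  rw [h1, sub_zero] at h2
  have hpart : partM fl α P A w i k = 0 := by
    show (splitEntry fl α (P w i) (remM fl α P A w i k)).1 = 0
    rw [h0 k]; exact h1
  refine ⟨hpart, ?_⟩
  rw [remM_succ_apply, h0 k]
  exact h2

/-- (15) as matrices: `A̲^(w) = A^(w) + A̲^(w+1)` exactly. [cite: OzakiOgitaOishiRump2012, §2.4 eq. (15)] -/
theorem remM_eq_partM_add (hfl : IsRoundNearest p emin fl) {β : ℕ} (hαβ : α + β = p) (hβ : 1 ≤ β)
    (hA : ∀ i k, IsFloat p emin (A i k)) (hV : ∀ w i k, |remM fl α P A w i k| ≤ (2 : ℚ) ^ P w i)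
    (hE : ∀ w i, emin ≤ (α : ℤ) + P w i) (w : ℕ) :
    remM fl α P A w = partM fl α P A w + remM fl α P A (w + 1) := by
  ext i k
  rw [Matrix.add_apply, (sweep_spec hfl hαβ hβ hA (hV w i k) (hE w i)).2.2.1]
  ring

/-- (16), format level: after ANY number `N` of sweeps, `A = Σ_{w<N} A^(w) + A̲^(N)` exactly.
[cite: OzakiOgitaOishiRump2012, §2.4 eq. (16)] -/
theorem eq_sum_parts_add_rem (hfl : IsRoundNearest p emin fl) {β : ℕ} (hαβ : α + β = p) (hβ : 1 ≤ β)
    (hA : ∀ i k, IsFloat p emin (A i k)) (hV : ∀ w i k, |remM fl α P A w i k| ≤ (2 : ℚ) ^ P w i)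
    (hE : ∀ w i, emin ≤ (α : ℤ) + P w i) (N : ℕ) :
    A = (∑ w ∈ range N, partM fl α P A w) + remM fl α P A N := by
  have := rem_zero_eq_sum_add_rem (partM fl α P A) (remM fl α P A)
    (remM_eq_partM_add hfl hαβ hβ hA hV hE) N
  rwa [remM_zero] at this

/-- (36) ⟹ (37): since `|a̲^(w+1)_{ik}| ≤ 2^{P^(w)ᵢ−β}`, the paper's choice (12)
`P^(w+1)ᵢ = ⌈log₂ max_k |a̲^(w+1)_{ik}|⌉` satisfies `P^(w+1)ᵢ ≤ P^(w)ᵢ − β` on every row that is not yet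
zero — `σ^(w+1) ≤ 2^{α−h}σ^(w)`; so a TIGHT schedule (hypothesis `hT` below) is always available.
[cite: OzakiOgitaOishiRump2012, §4.1 eqs. (36)–(37)] -/
theorem clog_rem_succ_le (hfl : IsRoundNearest p emin fl) {β : ℕ} (hαβ : α + β = p) (hβ : 1 ≤ β)
    (hA : ∀ i k, IsFloat p emin (A i k)) {w : ℕ} {i : Fin m} {k : Fin n}
    (hV : |remM fl α P A w i k| ≤ (2 : ℚ) ^ P w i) (hE : emin ≤ (α : ℤ) + P w i)
    (h0 : remM fl α P A (w + 1) i k ≠ 0) :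
    Int.clog 2 |remM fl α P A (w + 1) i k| ≤ P w i - β :=
  clog_le_of_abs_le h0 (sweep_spec hfl hαβ hβ hA hV hE).2.2.2

/-- (38): under a valid TIGHT schedule — `P^(w+1)ᵢ ≤ P^(w)ᵢ − β` unless row `i` of `A̲^(w+1)` is already
zero (its splitting has finished) — the scales decay geometrically while the row lives:
`σ^(w) ≤ 2^{(α−h)(w−1)}σ^(1)`, i.e. `P^(w)ᵢ ≤ P^(0)ᵢ − wβ` (0-based), or the row is zero.
[cite: OzakiOgitaOishiRump2012, §4.1 eq. (38)] -/
theorem schedule_decay (hfl : IsRoundNearest p emin fl) (hp : 1 ≤ p) {β : ℕ}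
    (hE : ∀ w i, emin ≤ (α : ℤ) + P w i)
    (hT : ∀ w i, P (w + 1) i ≤ P w i - β ∨ ∀ k, remM fl α P A (w + 1) i k = 0) (i : Fin m) :
    ∀ w : ℕ, P w i ≤ P 0 i - w * β ∨ ∀ k, remM fl α P A w i k = 0
  | 0 => Or.inl (by simp)
  | w + 1 => by
      rcases schedule_decay hfl hp hE hT i w with h | h
      · rcases hT w i with h' | h'
        · left; push_cast; linarith
        · exact Or.inr h'
      · exact Or.inr fun k => (partM_eq_zero_of_row_zero hfl hp h (hE w i) k).2

/-- (39) AND (40): under a valid tight schedule, `|A^(w)| ≤ 2^{(α−h)(w−1)}·2^{P^(1)}eᵀ` and the same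
bound for the remainder `|A̲^(w)|` (0-based: both `≤ 2^{P^(0)ᵢ − wβ}`).
[cite: OzakiOgitaOishiRump2012, §4.1 eqs. (39)–(40)] -/
theorem abs_le_decay (hfl : IsRoundNearest p emin fl) {β : ℕ} (hαβ : α + β = p) (hβ : 1 ≤ β)
    (hA : ∀ i k, IsFloat p emin (A i k)) (hV : ∀ w i k, |remM fl α P A w i k| ≤ (2 : ℚ) ^ P w i)
    (hE : ∀ w i, emin ≤ (α : ℤ) + P w i)
    (hT : ∀ w i, P (w + 1) i ≤ P w i - β ∨ ∀ k, remM fl α P A (w + 1) i k = 0)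
    (w : ℕ) (i : Fin m) (k : Fin n) :
    |partM fl α P A w i k| ≤ (2 : ℚ) ^ (P 0 i - w * β) ∧
      |remM fl α P A w i k| ≤ (2 : ℚ) ^ (P 0 i - w * β) := by
  have hp : 1 ≤ p := by omega
  rcases schedule_decay hfl hp hE hT i w with h | h
  · have hmono : (2 : ℚ) ^ P w i ≤ (2 : ℚ) ^ (P 0 i - w * β) := zpow_le_zpow_right₀ (by norm_num) h
    exact ⟨(sweep_spec hfl hαβ hβ hA (hV w i k) (hE w i)).2.1.trans hmono, (hV w i k).trans hmono⟩
  · have h2 : (0 : ℚ) ≤ (2 : ℚ) ^ (P 0 i - w * β) := (two_zpow_pos _).le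
    rw [(partM_eq_zero_of_row_zero hfl hp h (hE w i) k).1, h k, abs_zero]
    exact ⟨h2, h2⟩

/-- TERMINATION, (16) at format level: under a valid tight schedule with `β ≥ 1`, once `P^(0)ᵢ − wβ < emin`
row `i` of the remainder is zero (a float below `2^{emin}` vanishes).
[cite: OzakiOgitaOishiRump2012, §2.4 eq. (16) and Remark 4] -/
theorem remM_eq_zero_of_lt (hfl : IsRoundNearest p emin fl) {β : ℕ} (hαβ : α + β = p) (hβ : 1 ≤ β)
    (hA : ∀ i k, IsFloat p emin (A i k)) (hV : ∀ w i k, |remM fl α P A w i k| ≤ (2 : ℚ) ^ P w i)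
    (hE : ∀ w i, emin ≤ (α : ℤ) + P w i)
    (hT : ∀ w i, P (w + 1) i ≤ P w i - β ∨ ∀ k, remM fl α P A (w + 1) i k = 0)
    {w : ℕ} {i : Fin m} (hw : P 0 i - w * β < emin) (k : Fin n) : remM fl α P A w i k = 0 := by
  refine eq_zero_of_isFloat_of_abs_lt (isFloat_remM hfl hA w i k) ?_
  calc |remM fl α P A w i k| ≤ (2 : ℚ) ^ (P 0 i - w * β) := (abs_le_decay hfl hαβ hβ hA hV hE hT w i k).2
    _ < (2 : ℚ) ^ emin := zpow_lt_zpow_right₀ (by norm_num) hw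

/-- (16): "there exist constants `n_A ∈ ℕ` such that `A = Σ_{r≤n_A} A^(r)`, `A̲^(n_A+1) = O`" — with
`N := max_i ⌈P^(0)ᵢ − emin + 1⌉₊` sweeps (using `β ≥ 1`) the remainder vanishes and `A` is the unevaluated
sum of the `N` floating-point matrices `A^(w)`, `w < N`, each row of which has at most `β` significant
bits on its grid. [cite: OzakiOgitaOishiRump2012, §2.4 eq. (16)] -/
theorem eq_sum_parts (hfl : IsRoundNearest p emin fl) {β : ℕ} (hαβ : α + β = p) (hβ : 1 ≤ β)
    (hA : ∀ i k, IsFloat p emin (A i k)) (hV : ∀ w i k, |remM fl α P A w i k| ≤ (2 : ℚ) ^ P w i)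
    (hE : ∀ w i, emin ≤ (α : ℤ) + P w i)
    (hT : ∀ w i, P (w + 1) i ≤ P w i - β ∨ ∀ k, remM fl α P A (w + 1) i k = 0) :
    ∃ N : ℕ, remM fl α P A N = 0 ∧ A = ∑ w ∈ range N, partM fl α P A w := by
  set N : ℕ := Finset.univ.sup fun i : Fin m => (P 0 i - emin + 1).toNat with hN
  have hzero : remM fl α P A N = 0 := by
    ext i k
    rw [Matrix.zero_apply]
    refine remM_eq_zero_of_lt hfl hαβ hβ hA hV hE hT ?_ k
    have h1 : (P 0 i - emin + 1).toNat ≤ N :=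
      Finset.le_sup (f := fun i : Fin m => (P 0 i - emin + 1).toNat) (Finset.mem_univ i)
    have h2 : P 0 i - emin + 1 ≤ ((P 0 i - emin + 1).toNat : ℤ) := Int.self_le_toNat _
    have h3 : (N : ℤ) ≤ (N : ℤ) * β := by
      have : (1 : ℤ) ≤ β := by exact_mod_cast hβ
      nlinarith
    have h4 : ((P 0 i - emin + 1).toNat : ℤ) ≤ (N : ℤ) := by exact_mod_cast h1
    linarith
  refine ⟨N, hzero, ?_⟩
  have := eq_sum_parts_add_rem hfl hαβ hβ hA hV hE N
  rwa [hzero, add_zero] at this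

end Splitting

/-! ### Theorem 1 for the parts of the repeated splitting, and Theorem 2 (§4.1) -/

section MatrixProduct

variable {m n q : ℕ}

/-- Column-wise parts of `B`: the rows of `Bᵀ` are split (Algorithm 5: `E = SplitMat(Bᵀ, …)`, then
transposed back), scales `τ^(w)ⱼ = 2^α·2^{Q^(w)ⱼ}`. [cite: OzakiOgitaOishiRump2012, §2.4 eq. (15) and §3.1 Algorithm 5] -/
def partMc (fl : ℚ → ℚ) (α : ℕ) (Q : ℕ → Fin q → ℤ) (B : Matrix (Fin n) (Fin q) ℚ) (w : ℕ) :
    Matrix (Fin n) (Fin q) ℚ :=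
  (partM fl α Q Bᵀ w)ᵀ

/-- Column-wise remainders `B̲^(w+1)` of `B` (0-based). [cite: OzakiOgitaOishiRump2012, §2.4 eq. (15)] -/
def remMc (fl : ℚ → ℚ) (α : ℕ) (Q : ℕ → Fin q → ℤ) (B : Matrix (Fin n) (Fin q) ℚ) (w : ℕ) :
    Matrix (Fin n) (Fin q) ℚ :=
  (remM fl α Q Bᵀ w)ᵀ

variable {α β : ℕ} {P : ℕ → Fin m → ℤ} {Q : ℕ → Fin q → ℤ}
  {A : Matrix (Fin m) (Fin n) ℚ} {B : Matrix (Fin n) (Fin q) ℚ}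

/-- THEOREM 1 (as printed): for `A ∈ F^{m×n}`, `B ∈ F^{n×q}` split by (14)–(15) under valid schedules with
`α + β = p`, `β ≥ 1`, `n·2^{2β} ≤ 2^p` (eq. (22), automatic for `α = alpha p n`) and no underflow
(`2^{emin} ≤ u²σ^(r)ᵢτ^(s)ⱼ`), there is NO ROUNDOFF ERROR in `fl(A^(r)B^(s))` for all sweeps `r, s`,
whatever floating-point evaluation of the matrix product is used: `fl(A^(r)B^(s)) = A^(r)B^(s)`.
[cite: OzakiOgitaOishiRump2012, Theorem 1] -/
theorem theorem1 (hfl : IsRoundNearest p emin fl) (hαβ : α + β = p) (hβ : 1 ≤ β)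
    (hn : (n : ℚ) * (2 : ℚ) ^ (2 * β) ≤ (2 : ℚ) ^ p)
    (hA : ∀ i k, IsFloat p emin (A i k)) (hB : ∀ k j, IsFloat p emin (B k j))
    (hVA : ∀ w i k, |remM fl α P A w i k| ≤ (2 : ℚ) ^ P w i)
    (hVB : ∀ w j k, |remM fl α Q Bᵀ w j k| ≤ (2 : ℚ) ^ Q w j)
    (hEA : ∀ w i, emin ≤ (α : ℤ) + P w i) (hEB : ∀ w j, emin ≤ (α : ℤ) + Q w j)
    (r s : ℕ) (i : Fin m) (j : Fin q) (he : emin ≤ (P r i - β) + (Q s j - β)) (T : DotTree)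
    (hT : T.leaves.Perm (List.ofFn fun k => partM fl α P A r i k * partMc fl α Q B s k j)) :
    T.eval fl = (partM fl α P A r * partMc fl α Q B s) i j := by
  have hBt : ∀ j k, IsFloat p emin (Bᵀ j k) := fun j k => hB k j
  have h2 : (2 : ℚ) ≠ 0 := by norm_num
  rw [Matrix.mul_apply]
  refine dot_eval_eq_exact (by omega) hfl (c := P r i - β) (d := Q s j - β) (s := β) (t := β)
    (fun k => partM fl α P A r i k) (fun k => partMc fl α Q B s k j) ?_ ?_ ?_ ?_ (by rwa [← two_mul]) he T hT
  · exact fun k => (sweep_spec hfl hαβ hβ hA (hVA r i k) (hEA r i)).1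
  · intro k
    have h := (sweep_spec hfl hαβ hβ hA (hVA r i k) (hEA r i)).2.1
    rwa [← zpow_natCast, ← zpow_add₀ h2, show (β : ℤ) + (P r i - β) = P r i by ring]
  · exact fun k => (sweep_spec hfl hαβ hβ hBt (hVB s j k) (hEB s j)).1
  · intro k
    have h := (sweep_spec hfl hαβ hβ hBt (hVB s j k) (hEB s j)).2.1
    show |partM fl α Q Bᵀ s j k| ≤ _
    rwa [← zpow_natCast, ← zpow_add₀ h2, show (β : ℤ) + (Q s j - β) = Q s j by ring]


/-- THEOREM 1 WITH THE PAPER'S CONSTANTS `α` (11) AND `β` (6): for `n ≤ 2^{p−2}` (so that `β ≥ 1`;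
binary64: `n ≤ 2⁵¹`), (22) holds automatically and `fl(A^(r)B^(s)) = A^(r)B^(s)` for the splittings with
`σ^(w)ᵢ = 2^α 2^{P^(w)ᵢ}`, `τ^(w)ⱼ = 2^α 2^{Q^(w)ⱼ}`. [cite: OzakiOgitaOishiRump2012, Theorem 1 with eqs. (6), (11), (22)] -/
theorem theorem1_canonical (hfl : IsRoundNearest p emin fl) (hnp : Nat.clog 2 n + 2 ≤ p)
    (hA : ∀ i k, IsFloat p emin (A i k)) (hB : ∀ k j, IsFloat p emin (B k j))
    (hVA : ∀ w i k, |remM fl (alpha p n) P A w i k| ≤ (2 : ℚ) ^ P w i)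
    (hVB : ∀ w j k, |remM fl (alpha p n) Q Bᵀ w j k| ≤ (2 : ℚ) ^ Q w j)
    (hEA : ∀ w i, emin ≤ (alpha p n : ℤ) + P w i) (hEB : ∀ w j, emin ≤ (alpha p n : ℤ) + Q w j)
    (r s : ℕ) (i : Fin m) (j : Fin q) (he : emin ≤ (P r i - beta p n) + (Q s j - beta p n))
    (T : DotTree)
    (hT : T.leaves.Perm
      (List.ofFn fun k => partM fl (alpha p n) P A r i k * partMc fl (alpha p n) Q B s k j)) :
    T.eval fl = (partM fl (alpha p n) P A r * partMc fl (alpha p n) Q B s) i j :=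
  theorem1 hfl (alpha_add_beta (by omega)) (alpha_lt_and_one_le_beta hnp).2
    (mul_pow_two_beta_le_rat (by omega)) hA hB hVA hVB hEA hEB r s i j he T hT

/-- (29) FOR THE SPLITTINGS (14)–(15): the exact product expands as
`AB = Σ_{r+s<K} A^(r)B^(s) + Σ_{r<K} A^(r)B̲^(K−r) + A̲^(K)B` (0-based, `K = k − 1`).
[cite: OzakiOgitaOishiRump2012, §3.1 eq. (29)] -/
theorem mul_eq_expansion (hfl : IsRoundNearest p emin fl) (hαβ : α + β = p) (hβ : 1 ≤ β)
    (hA : ∀ i k, IsFloat p emin (A i k)) (hB : ∀ k j, IsFloat p emin (B k j))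
    (hVA : ∀ w i k, |remM fl α P A w i k| ≤ (2 : ℚ) ^ P w i)
    (hVB : ∀ w j k, |remM fl α Q Bᵀ w j k| ≤ (2 : ℚ) ^ Q w j)
    (hEA : ∀ w i, emin ≤ (α : ℤ) + P w i) (hEB : ∀ w j, emin ≤ (α : ℤ) + Q w j) (K : ℕ) :
    A * B = (∑ r ∈ range K, ∑ s ∈ range (K - r), partM fl α P A r * partMc fl α Q B s)
      + (∑ r ∈ range K, partM fl α P A r * remMc fl α Q B (K - r)) + remM fl α P A K * B := by
  have hBt : ∀ j k, IsFloat p emin (Bᵀ j k) := fun j k => hB k j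
  have ha := remM_eq_partM_add hfl hαβ hβ hA hVA hEA
  have hb' := remM_eq_partM_add hfl hαβ hβ hBt hVB hEB
  have hb : ∀ w, remMc fl α Q B w = partMc fl α Q B w + remMc fl α Q B (w + 1) := by
    intro w; unfold remMc partMc; rw [hb' w, Matrix.transpose_add]
  have h := mul_expansion (partM fl α P A) (remM fl α P A) (partMc fl α Q B) (remMc fl α Q B) ha hb K
  have h0 : remMc fl α Q B 0 = B := by unfold remMc; rw [remM_zero, Matrix.transpose_transpose]
  rwa [remM_zero, h0] at h

/-- The error of one inexact product of the expansion: if `|xₖ|·|yₖ| ≤ M` for all `k` then, for any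
evaluation, `|fl(xᵀy) − xᵀy| ≤ γₙ·(nM) + n·2^{emin}` (eq. (34) from [8], in the any-order form of
`JeannerodRump2013`, with the format-level underflow term). [cite: OzakiOgitaOishiRump2012, §4.1 eq. (34)] -/
theorem abs_eval_sub_dot_le (hp : 1 ≤ p) (hfl : IsRoundNearest p emin fl) (x y : Fin n → ℚ)
    (T : DotTree) (hT : T.leaves.Perm (List.ofFn fun k => x k * y k))
    (hnu : 2 * (n : ℚ) * unitRoundoff p ≤ 1) {M : ℚ} (hM : ∀ k, |x k| * |y k| ≤ M) :
    |T.eval fl - ∑ k, x k * y k| ≤ gamma (unitRoundoff p) n * (n * M) + n * (2 : ℚ) ^ emin := by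
  have h := abs_dot_sub_le_gamma hp hfl x y T hT hnu
  have hs : ∑ k, |x k| * |y k| ≤ n * M :=
    calc ∑ k, |x k| * |y k| ≤ ∑ _k : Fin n, M := Finset.sum_le_sum fun k _ => hM k
      _ = n * M := by rw [Finset.sum_const, Finset.card_univ, Fintype.card_fin, nsmul_eq_mul]
  have hu0 : 0 ≤ unitRoundoff p := u_pos.le
  have hnu1 : (n : ℚ) * unitRoundoff p < 1 := by nlinarith [Nat.cast_nonneg (α := ℚ) n]
  have hg : 0 ≤ gamma (unitRoundoff p) n := Higham2002.gamma_nonneg hu0 hnu1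
  have := mul_le_mul_of_nonneg_left hs hg
  linarith

/-- The decay bounds multiply: `|x| ≤ 2^{P₀ − rβ}`, `|y| ≤ 2^{Q₀ − sβ}`, `r + s = K` ⟹
`|x||y| ≤ 2^{P₀ + Q₀ − Kβ}` (eq. (41): `2^{(α−h)(i−1)}2^{(α−h)(j−1)} = 2^{(α−h)(i+j−2)}`).
[cite: OzakiOgitaOishiRump2012, §4.1 eq. (41)] -/
theorem abs_mul_le_of_decay {x y : ℚ} {P₀ Q₀ : ℤ} {β r s K : ℕ} (hx : |x| ≤ (2 : ℚ) ^ (P₀ - r * β))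
    (hy : |y| ≤ (2 : ℚ) ^ (Q₀ - s * β)) (hrs : r + s = K) :
    |x| * |y| ≤ (2 : ℚ) ^ (P₀ + Q₀ - K * β) := by
  have hK : (K : ℤ) = r + s := by rw [← hrs]; push_cast; ring
  calc |x| * |y| ≤ (2 : ℚ) ^ (P₀ - r * β) * (2 : ℚ) ^ (Q₀ - s * β) :=
        mul_le_mul hx hy (abs_nonneg y) (two_zpow_pos _).le
    _ = (2 : ℚ) ^ (P₀ + Q₀ - K * β) := by
        rw [← zpow_add₀ (by norm_num : (2 : ℚ) ≠ 0), hK]; congr 1; ring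

/-- THEOREM 2, EQ. (30), entrywise at format level. `A ∈ F^{m×n}` and `B ∈ F^{n×q}` are split by
(14)–(15) (`k − 1 = K` sweeps used) under valid tight schedules with float scales, `α + β = p`, `β ≥ 1`,
`n·2^{2β} ≤ 2^p` (22) and `2nu ≤ 1`; the `k(k−1)/2 + k` products of (29) are evaluated by ARBITRARY
floating-point matrix-multiplication routines (one `DotTree` per product and entry) and
`C := Σ_{r+s<K} fl(A^(r)B^(s)) + Σ_{r<K} fl(A^(r)B̲^(K−r)) + fl(A̲^(K)B)` (exact sum of the computed
matrices, as in the statement of Theorem 2). If no product grid of the error-free group underflows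
(`2^{emin} ≤ u²σ^(r)ᵢτ^(s)ⱼ` for `r + s < K`), then
`|C − AB|ᵢⱼ ≤ k·n·γₙ·2^{(α−h)(k−1)}·2^{P^(1)ᵢ}·2^{Q^(1)ⱼ} + k·n·2^{emin}` — the printed bound `E` of (30)
(`2^{(α−h)(k−1)} = 2^{−βK}`) plus the format-level underflow allowance of the `k` inexact products, which
vanishes under the paper's standing assumption "no underflow". [cite: OzakiOgitaOishiRump2012, Theorem 2 eq. (30)] -/
theorem theorem2 (hfl : IsRoundNearest p emin fl) (hαβ : α + β = p) (hβ : 1 ≤ β)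
    (hn : (n : ℚ) * (2 : ℚ) ^ (2 * β) ≤ (2 : ℚ) ^ p) (hnu : 2 * (n : ℚ) * unitRoundoff p ≤ 1)
    (hA : ∀ i k, IsFloat p emin (A i k)) (hB : ∀ k j, IsFloat p emin (B k j))
    (hVA : ∀ w i k, |remM fl α P A w i k| ≤ (2 : ℚ) ^ P w i)
    (hVB : ∀ w j k, |remM fl α Q Bᵀ w j k| ≤ (2 : ℚ) ^ Q w j)
    (hEA : ∀ w i, emin ≤ (α : ℤ) + P w i) (hEB : ∀ w j, emin ≤ (α : ℤ) + Q w j)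
    (hTA : ∀ w i, P (w + 1) i ≤ P w i - β ∨ ∀ k, remM fl α P A (w + 1) i k = 0)
    (hTB : ∀ w j, Q (w + 1) j ≤ Q w j - β ∨ ∀ k, remM fl α Q Bᵀ (w + 1) j k = 0)
    (K : ℕ) (i : Fin m) (j : Fin q) (he : ∀ r s, r + s < K → emin ≤ (P r i - β) + (Q s j - β))
    (T₁ : ℕ → ℕ → DotTree)
    (hT₁ : ∀ r s, r + s < K →
      (T₁ r s).leaves.Perm (List.ofFn fun k => partM fl α P A r i k * partMc fl α Q B s k j))
    (T₂ : ℕ → DotTree)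
    (hT₂ : ∀ r, r < K →
      (T₂ r).leaves.Perm (List.ofFn fun k => partM fl α P A r i k * remMc fl α Q B (K - r) k j))
    (T₃ : DotTree) (hT₃ : T₃.leaves.Perm (List.ofFn fun k => remM fl α P A K i k * B k j)) :
    |((∑ r ∈ range K, ∑ s ∈ range (K - r), (T₁ r s).eval fl) + (∑ r ∈ range K, (T₂ r).eval fl)
        + T₃.eval fl) - (A * B) i j|
      ≤ ((K : ℚ) + 1) * (gamma (unitRoundoff p) n * (n * (2 : ℚ) ^ (P 0 i + Q 0 j - K * β))
          + n * (2 : ℚ) ^ emin) := by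
  have hp : 1 ≤ p := by omega
  have hBt : ∀ j k, IsFloat p emin (Bᵀ j k) := fun j k => hB k j
  -- the exact expansion (29), at the entry (i, j)
  have hexp := congrFun (congrFun (mul_eq_expansion hfl hαβ hβ hA hB hVA hVB hEA hEB K) i) j
  simp only [Matrix.add_apply, Matrix.sum_apply] at hexp
  -- the error-free group (Theorem 1)
  have hS1 : ∑ r ∈ range K, ∑ s ∈ range (K - r), (T₁ r s).eval fl
      = ∑ r ∈ range K, ∑ s ∈ range (K - r), (partM fl α P A r * partMc fl α Q B s) i j := by
    refine sum_congr rfl fun r hr => sum_congr rfl fun s hs => ?_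
    rw [mem_range] at hr hs
    have hrs : r + s < K := by omega
    exact theorem1 hfl hαβ hβ hn hA hB hVA hVB hEA hEB r s i j (he r s hrs) (T₁ r s) (hT₁ r s hrs)
  -- the k inexact products, each with error ≤ E₁
  set E₁ : ℚ := gamma (unitRoundoff p) n * (n * (2 : ℚ) ^ (P 0 i + Q 0 j - K * β))
    + n * (2 : ℚ) ^ emin with hE₁
  have h2 : ∀ r ∈ range K,
      |(T₂ r).eval fl - (partM fl α P A r * remMc fl α Q B (K - r)) i j| ≤ E₁ := by
    intro r hr
    rw [mem_range] at hr
    rw [Matrix.mul_apply]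
    refine abs_eval_sub_dot_le hp hfl _ _ (T₂ r) (hT₂ r hr) hnu fun k => ?_
    exact abs_mul_le_of_decay (abs_le_decay hfl hαβ hβ hA hVA hEA hTA r i k).1
      (abs_le_decay hfl hαβ hβ hBt hVB hEB hTB (K - r) j k).2 (by omega)
  have h3 : |T₃.eval fl - (remM fl α P A K * B) i j| ≤ E₁ := by
    rw [Matrix.mul_apply]
    refine abs_eval_sub_dot_le hp hfl _ _ T₃ hT₃ hnu fun k => ?_
    have hBk : |B k j| ≤ (2 : ℚ) ^ (Q 0 j - (0 : ℕ) * β) := by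
      have := (abs_le_decay hfl hαβ hβ hBt hVB hEB hTB 0 j k).2
      rwa [remM_zero] at this
    exact abs_mul_le_of_decay (abs_le_decay hfl hαβ hβ hA hVA hEA hTA K i k).2 hBk (by omega)
  have hS2 : |(∑ r ∈ range K, (T₂ r).eval fl)
      - ∑ r ∈ range K, (partM fl α P A r * remMc fl α Q B (K - r)) i j| ≤ K * E₁ := by
    rw [← sum_sub_distrib]
    refine (abs_sum_le_sum_abs _ _).trans ?_
    calc ∑ r ∈ range K, |(T₂ r).eval fl - (partM fl α P A r * remMc fl α Q B (K - r)) i j|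
        ≤ ∑ _r ∈ range K, E₁ := sum_le_sum h2
      _ = K * E₁ := by rw [sum_const, card_range, nsmul_eq_mul]
  rw [hS1, hexp]
  have halg : ∀ a b c b' c' : ℚ, a + b + c - (a + b' + c') = (b - b') + (c - c') := fun _ _ _ _ _ => by ring
  rw [halg]
  calc _ ≤ |(∑ r ∈ range K, (T₂ r).eval fl)
            - ∑ r ∈ range K, (partM fl α P A r * remMc fl α Q B (K - r)) i j|
          + |T₃.eval fl - (remM fl α P A K * B) i j| := abs_add_le _ _
    _ ≤ K * E₁ + E₁ := add_le_add hS2 h3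
    _ = ((K : ℚ) + 1) * E₁ := by ring

/-- THEOREM 2, EQ. (31): if the `t = k(k−1)/2 + k` computed matrices `G̃^(v)` are finally summed in
ordinary floating-point arithmetic, in ANY order (`D^(1) = fl(Σ_v G̃^(v))`, entrywise floats `G̃^(v)_{ij}`
with exact sum `C_{ij}`), then `|D^(1) − AB| ≤ |C − AB| + (t−1)u·Σ_v|G̃^(v)|` (the any-order summation
bound `(t−1)u ≤ γ_{t−1}` of `JeannerodRump2013`/`JeannerodRump2018`), to be combined with (30).
[cite: OzakiOgitaOishiRump2012, Theorem 2 eq. (31)] -/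
theorem final_sum_error (hp : 2 ≤ p) (hfl : IsRoundNearest p emin fl) (S : SumTree)
    (hS : ∀ x ∈ S.leaves, IsFloat p emin x) (ab : ℚ) :
    |S.eval fl - ab| ≤ |S.exact - ab|
      + ((S.leaves.length : ℚ) - 1) * unitRoundoff p * (S.leaves.map abs).sum := by
  have h := JeannerodRump2013.proposition31 hp hfl S hS
  have : S.eval fl - ab = (S.eval fl - S.exact) + (S.exact - ab) := by ring
  rw [this]
  calc |(S.eval fl - S.exact) + (S.exact - ab)| ≤ |S.eval fl - S.exact| + |S.exact - ab| := abs_add_le _ _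
    _ ≤ _ := by linarith

end MatrixProduct

end Literature.ComputerArithmetic.OzakiOgitaOishiRump2012
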